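import Literature.NumberTheory.LFunctions.MontgomeryDirichletSumMeanSquareSharp
import Literature.NumberTheory.LFunctions.MontgomeryExplicitFormulaProofs
import Literature.NumberTheory.LFunctions.DirichletPolynomialDiscreteMeanValue
import HarnessLib

/-!
# Montgomery's theorem with the Goldston–Montgomery error term, uniformly for `0 ≤ α ≤ 1`

Topic `Literature/NumberTheory/LFunctions` (namespace `Literature.NumberTheory.LFunctions`, proof objects in
`Montgomery`). Proofs only: no definitions, no named facts. LABEL: RH is the printed ANTECEDENT of the
theorem (as in Montgomery 1973); nothing here bears on the truth of RH.

The tree's `montgomery_pair_correlation_restricted(_holds)` (`RHConditionalFacts.lean`,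
`MontgomeryExplicitFormulaProofs.lean`) is Montgomery's theorem in the `o(1)` form, uniformly on
`|α| ≤ 1 − δ`. Here we prove the form with the Goldston–Montgomery error term, uniformly on the CLOSED
interval, exactly as stated by Baluyot–Goldston–Suriajaya–Turnage-Butterbaugh 2025, (MT)/(MTeq) ("We now
state Montgomery's theorem which incorporates some improvements from [GM87] … Assume the Riemann Hypothesis.
The function `F(α)` is real, even, and nonnegative. Moreover, as `T → ∞`, we have
`F(α) = T^{−2α} log T (1 + O(1/√log T)) + α + O(1/√log T)` uniformly for `0 ≤ α ≤ 1`"; their remark: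
"We have removed an extraneous factor of `log log T` from [GM87] which can be avoided using Lemma 6 there
in place of Lemma 7"), i.e. Goldston–Montgomery 1987, Lemma 8 ("Assume RH … `F(X,T) ≥ 0`,
`F(X,T) = F(1/X,T)`, and `F(X,T) = T(X⁻² log² T + log X)(1/2π + O(…))` uniformly for `1 ≤ X ≤ T` … The
estimate is substantially due to Goldston [Lemma B], and may be proved by substituting an appeal to Lemma 7
in the argument of Montgomery") without the `log log`:

* `Montgomery.montgomeryPairSum_nonneg`, `montgomeryFormFactor_nonneg` — `F(x,T) ≥ 0`, `F(α,T) ≥ 0`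
  (unconditionally; GM87 (25)/(26): "an immediate consequence of
  `F(X,T) = (2/π) ∫ |∑_{0<γ≤T} X^{iγ}/(1+(t−γ)²)|² dt`", the tree's `Montgomery.integral_norm_partial_sq`);
* `Montgomery.core_estimate_sharp` — Montgomery's argument (Goldston 2005, §4, (4.5)–(4.9)), i.e. the tree's
  `Montgomery.core_estimate`, with exactly two changes: (P3) is replaced by (P3♯)
  `Montgomery.exists_meanSquare_dirichletSum_sharp` (Goldston–Montgomery's Lemmas 6–7, files
  `DirichletPolynomialSelbergMVT.lean`, `MontgomeryDirichletSumMeanSquareSharp.lean`), which removes the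
  restriction `α ≤ 1 − δ`; and the cross term between the Dirichlet series `A(x,t)` and the `log(|t|+2)`-term
  of the explicit formula is EVALUATED (integration by parts: `∫_0^T n^{-it} log(t+2) dt ≪ log T/log n`,
  `Montgomery.norm_integral_log_mul_cpow_le`, so the cross term is `≪ x^{1/2} log T`,
  `Montgomery.exists_norm_integral_log_mul_dirichletSum_le`) instead of being bounded by Cauchy–Schwarz,
  which removes the `log log T`;
* `montgomery_pair_correlation_sqrtLog_Icc`, `montgomery_pair_correlation_sqrtLog` — **the theorem**:
  assuming RH there is `C` such that for all large `T` and all `0 ≤ α ≤ 1` (resp. `|α| ≤ 1`),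
  `|F(α,T) − (T^{−2α} log T + α)| ≤ C (T^{−2α} log T + 1)/√(log T)`.

## References

* [BaluyotGoldstonSuriajayaTurnageButterbaugh2025] arXiv:2508.10857, §2, (MT)/(MTeq) and the remarks after it
  (unrefereed; the statement proved here). [claim: BaluyotGoldstonSuriajayaTurnageButterbaugh2025, status: under-review]
* [GoldstonMontgomery1987] D. A. Goldston, H. L. Montgomery, *Pair correlation of zeros and primes in short
  intervals*, Progr. Math. 70 (1987), 183–203, §3, Lemmas 6–8 (read on the scanned page).
* [Goldston2005] D. A. Goldston, *Notes on pair correlation of zeros and prime numbers*, §4 and the remark after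
  Theorem 1 ("[GoMo] … shows the theorem holds for `0 ≤ α ≤ 1`").
* [Montgomery1973] H. L. Montgomery, *The pair correlation of zeros of the zeta function*, Theorem.
-/

noncomputable section

open Finset Real MeasureTheory Complex Filter Set
open ArithmeticFunction hiding log id
open scoped Topology ComplexConjugate

namespace Literature.NumberTheory.LFunctions

namespace Montgomery

/-! ## §1. `F ≥ 0` -/

/-- **`F(x, T) ≥ 0`** (Goldston–Montgomery 1987, Lemma 8, first assertion, via their (26):
`F(X,T) = (2/π) ∫_ℝ |∑_{0<γ≤T} X^{iγ}/(1+(t−γ)²)|² dt`; unconditional). [cite: GoldstonMontgomery1987, §3 Lemma 8] -/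
theorem montgomeryPairSum_nonneg {x : ℝ} (hx : 0 < x) (T : ℝ) : 0 ≤ montgomeryPairSum x T := by
  have h := integral_norm_partial_sq hx T
  have hI : 0 ≤ ∫ t : ℝ, ‖∑ n ∈ Finset.range (zetaZeroCount T),
      (x : ℂ) ^ ((zetaOrdinate n : ℂ) * I) / ((1 + (t - zetaOrdinate n) ^ 2 : ℝ) : ℂ)‖ ^ 2 :=
    integral_nonneg fun t ↦ by positivity
  rw [h] at hI
  have hπ : (0 : ℝ) < π / 2 := by positivity
  exact (mul_nonneg_iff_of_pos_left hπ).1 hI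

/-- **`F(α, T) ≥ 0` for `T > 1`** (BGSTB 2025 (MT): "`F(α)` is real, even, and nonnegative"; Montgomery 1973
prints "`F(α) ≥ −ε` for `T > T₀(ε)`"; exact nonnegativity is Goldston–Montgomery 1987, Lemma 8 /
Mueller, unconditional). [cite: GoldstonMontgomery1987, §3 Lemma 8] -/
theorem montgomeryFormFactor_nonneg (α : ℝ) {T : ℝ} (hT : 1 < T) : 0 ≤ montgomeryFormFactor α T := by
  rw [montgomeryFormFactor_eq_montgomeryPairSum α (by linarith)]
  have hlog : 0 < Real.log T := Real.log_pos hT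
  exact mul_nonneg (by positivity) (montgomeryPairSum_nonneg (Real.rpow_pos_of_pos (by linarith) α) T)

/-! ## §2. The oscillatory integral `∫_0^T n^{-it} log(t+2) dt` -/

/-- **Integration by parts**: for `n ≥ 2` and `T ≥ 0`,
`|∫_0^T log(t+2) n^{-it} dt| ≤ 2 log(T+2)/log n`
(`n^{-it} = d/dt [n^{-it}/(−i log n)]`, `|[log(t+2) n^{-it}/(−i log n)]_0^T| ≤ (log(T+2) + log 2)/log n`,
`|∫_0^T n^{-it}/((t+2)(−i log n)) dt| ≤ (log(T+2) − log 2)/log n`). [folklore] -/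
private theorem norm_integral_log_mul_cpow_le {n : ℕ} (hn : 2 ≤ n) {T : ℝ} (hT : 0 ≤ T) :
    ‖∫ t in (0 : ℝ)..T, (Real.log (t + 2) : ℂ) * (n : ℂ) ^ (-((t : ℂ) * I))‖ ≤
      2 * Real.log (T + 2) / Real.log n := by
  have hn0 : n ≠ 0 := by omega
  set ω : ℝ := Real.log n with hω
  have hω0 : 0 < ω := Real.log_pos (by exact_mod_cast (by omega : 1 < n))
  set d : ℂ := -((ω : ℂ) * I) with hd
  have hdnorm : ‖d‖ = ω := by
    rw [hd, norm_neg, norm_mul, Complex.norm_real, Complex.norm_I, mul_one, Real.norm_of_nonneg hω0.le]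
  have hd0 : d ≠ 0 := by
    intro h; rw [← norm_eq_zero, hdnorm] at h; exact hω0.ne' h
  -- `e(t) = n^{-it}`, `v = e/d`, `v' = e`
  set e : ℝ → ℂ := fun t ↦ (n : ℂ) ^ (-((t : ℂ) * I)) with he
  have henorm : ∀ t : ℝ, ‖e t‖ = 1 := fun t ↦ by
    simp only [he]; rw [natCast_cpow_neg_mul_I hn0, Complex.norm_exp_ofReal_mul_I]
  have hev : ∀ t : ℝ, HasDerivAt (fun y : ℝ ↦ e y / d) (e t) t := by
    intro t
    have h := (hasDerivAt_natCast_cpow_neg_mul_I hn0 t).div_const d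
    have hnum : (n : ℂ) ^ (-((t : ℂ) * I)) * (-(Real.log n : ℂ) * I) / d = e t := by
      rw [show (-(Real.log n : ℂ) * I) = d by rw [hd, hω, neg_mul], mul_div_assoc, div_self hd0, mul_one]
    exact h.congr_deriv hnum
  -- `u(t) = log(t+2)`, `u' = 1/(t+2)`
  have heu : ∀ t ∈ Set.uIcc 0 T, HasDerivAt (fun y : ℝ ↦ (Real.log (y + 2) : ℂ)) (((1 / (t + 2) : ℝ)) : ℂ) t := by
    intro t ht
    rw [Set.uIcc_of_le hT] at ht
    have ht2 : t + 2 ≠ 0 := by linarith [ht.1]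
    have h1 : HasDerivAt (fun y : ℝ ↦ Real.log (y + 2)) (1 / (t + 2)) t := by
      have := ((hasDerivAt_id t).add_const 2).log ht2
      simpa using this
    exact h1.ofReal_comp
  have hcu' : ContinuousOn (fun t : ℝ ↦ (((1 / (t + 2) : ℝ)) : ℂ)) (Set.uIcc 0 T) := by
    refine Complex.continuous_ofReal.comp_continuousOn (ContinuousOn.div continuousOn_const (by fun_prop) ?_)
    intro t ht; rw [Set.uIcc_of_le hT] at ht; linarith [ht.1]
  have hce : Continuous e := continuous_natCast_cpow_neg_mul_I hn0
  have hparts := intervalIntegral.integral_mul_deriv_eq_deriv_mul heu (fun t _ ↦ hev t)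
    (hcu'.intervalIntegrable) (hce.intervalIntegrable 0 T)
  -- bound the three pieces
  have hlogT : 0 ≤ Real.log (T + 2) := Real.log_nonneg (by linarith)
  have hlog2 : 0 ≤ Real.log 2 := Real.log_nonneg (by norm_num)
  have hb1 : ‖(Real.log (T + 2) : ℂ) * (e T / d)‖ = Real.log (T + 2) / ω := by
    rw [norm_mul, norm_div, henorm, hdnorm, Complex.norm_real, Real.norm_of_nonneg hlogT]; ring
  have hb2 : ‖(Real.log ((0 : ℝ) + 2) : ℂ) * (e 0 / d)‖ = Real.log 2 / ω := by
    rw [zero_add, norm_mul, norm_div, henorm, hdnorm, Complex.norm_real, Real.norm_of_nonneg hlog2]; ring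
  have hb3 : ‖∫ t in (0 : ℝ)..T, (((1 / (t + 2) : ℝ)) : ℂ) * (e t / d)‖ ≤ (Real.log (T + 2) - Real.log 2) / ω := by
    have hle : ‖∫ t in (0 : ℝ)..T, (((1 / (t + 2) : ℝ)) : ℂ) * (e t / d)‖ ≤ ∫ t in (0 : ℝ)..T, (t + 2)⁻¹ / ω := by
      refine intervalIntegral.norm_integral_le_of_norm_le hT ?_ ?_
      · refine Eventually.of_forall fun t ht ↦ ?_
        have ht2 : 0 < t + 2 := by linarith [ht.1.le]
        rw [norm_mul, norm_div, henorm, hdnorm, Complex.norm_real, Real.norm_of_nonneg (by positivity)]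
        exact le_of_eq (by rw [one_div]; ring)
      · refine ContinuousOn.intervalIntegrable ?_
        refine ContinuousOn.div_const (ContinuousOn.inv₀ (by fun_prop) fun t ht ↦ ?_) _
        rw [Set.uIcc_of_le hT] at ht; linarith [ht.1]
    refine hle.trans (le_of_eq ?_)
    rw [intervalIntegral.integral_div, intervalIntegral.integral_comp_add_right (fun t : ℝ ↦ t⁻¹) 2,
      integral_inv_of_pos (by norm_num) (by linarith), zero_add, Real.log_div (by linarith) (by norm_num)]
  rw [hparts]
  calc ‖(Real.log (T + 2) : ℂ) * (e T / d) - (Real.log ((0 : ℝ) + 2) : ℂ) * (e 0 / d) -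
        ∫ t in (0 : ℝ)..T, (((1 / (t + 2) : ℝ)) : ℂ) * (e t / d)‖
      ≤ ‖(Real.log (T + 2) : ℂ) * (e T / d) - (Real.log ((0 : ℝ) + 2) : ℂ) * (e 0 / d)‖ +
        ‖∫ t in (0 : ℝ)..T, (((1 / (t + 2) : ℝ)) : ℂ) * (e t / d)‖ := norm_sub_le _ _
    _ ≤ ‖(Real.log (T + 2) : ℂ) * (e T / d)‖ + ‖(Real.log ((0 : ℝ) + 2) : ℂ) * (e 0 / d)‖ +
        ‖∫ t in (0 : ℝ)..T, (((1 / (t + 2) : ℝ)) : ℂ) * (e t / d)‖ := by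
        gcongr; exact norm_sub_le _ _
    _ ≤ Real.log (T + 2) / ω + Real.log 2 / ω + (Real.log (T + 2) - Real.log 2) / ω := by
        rw [hb1, hb2]; gcongr
    _ = 2 * Real.log (T + 2) / ω := by field_simp; ring

/-! ## §3. The cross term `∫_0^T A(x,t) log(t+2) dt` -/

/-- **The cross term**: there is an absolute `K` such that for `x ≥ 1` and `T ≥ 0`,
`|∫_0^T log(t+2) A(x,t) dt| ≤ K x log(T+2)`, `A(x,t) = ∑_n Λ(n)a_n(x) n^{-it}`: integrate termwise
(absolute convergence), `|∫_0^T log(t+2) n^{-it} dt| ≤ 2 log(T+2)/log n ≤ 2 log(T+2)/log 2` for `n ≥ 2`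
(`Λ(1) = 0`), and `∑_n Λ(n) a_n(x) ≤ 13(log 4 + 4) x` (`Montgomery.sum_Icc_montgomeryCoeff_le`). [folklore] -/
private theorem exists_norm_integral_log_mul_dirichletSum_le :
    ∃ K : ℝ, 0 ≤ K ∧ ∀ x : ℝ, 1 ≤ x → ∀ T : ℝ, 0 ≤ T →
      ‖∫ t in (0 : ℝ)..T, (Real.log (t + 2) : ℂ) * montgomeryDirichletSum x t‖ ≤
        K * x * Real.log (T + 2) := by
  have hK0 : 0 ≤ 2 / Real.log 2 * (13 * (Real.log 4 + 4)) := by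
    have := Real.log_pos (by norm_num : (1:ℝ) < 2)
    have := Real.log_nonneg (by norm_num : (1:ℝ) ≤ 4)
    positivity
  refine ⟨2 / Real.log 2 * (13 * (Real.log 4 + 4)), hK0, fun x hx T hT ↦ ?_⟩
  have hx0 : 0 < x := by linarith
  have hl2 : 0 < Real.log 2 := Real.log_pos (by norm_num)
  have hl4 : 0 ≤ Real.log 4 := Real.log_nonneg (by norm_num)
  have hlogT : 0 ≤ Real.log (T + 2) := Real.log_nonneg (by linarith)
  set c : ℕ → ℝ := montgomeryCoeff x with hc
  have hc0 : ∀ n, 0 ≤ c n := fun n ↦ montgomeryCoeff_nonneg hx0.le n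
  -- the terms `log(t+2) c_n n^{-it}` on `(0, T]`
  set F : ℕ → ℝ → ℂ := fun n t ↦ (Real.log (t + 2) : ℂ) * ((c n : ℂ) * (n : ℂ) ^ (-((t : ℂ) * I))) with hF
  have hFnorm : ∀ n, ∀ t ∈ Set.Ioc 0 T, ‖F n t‖ ≤ Real.log (T + 2) * c n := by
    intro n t ht
    simp only [hF, norm_mul]
    have h1 : ‖(Real.log (t + 2) : ℂ)‖ ≤ Real.log (T + 2) := by
      rw [Complex.norm_real, Real.norm_of_nonneg (Real.log_nonneg (by linarith [ht.1]))]
      exact Real.log_le_log (by linarith [ht.1]) (by linarith [ht.2])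
    have h2 : ‖(c n : ℂ)‖ * ‖(n : ℂ) ^ (-((t : ℂ) * I))‖ ≤ c n := by
      have := norm_montgomeryDirichletSummand_le hx0 t n
      rwa [norm_mul] at this
    exact mul_le_mul h1 h2 (by positivity) hlogT
  have hFmeas : ∀ n, Measurable (F n) := by
    intro n
    rcases Nat.eq_zero_or_pos n with rfl | hn
    · have : F 0 = fun _ ↦ 0 := by funext t; simp [hF, hc]
      rw [this]; exact measurable_const
    · simp only [hF]
      refine Measurable.mul ?_ (measurable_const.mul (continuous_natCast_cpow_neg_mul_I hn.ne').measurable)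
      exact Complex.measurable_ofReal.comp (Real.measurable_log.comp (measurable_id.add_const 2))
  have hFint : ∀ n, Integrable (F n) (volume.restrict (Set.Ioc 0 T)) := by
    intro n
    refine Measure.integrableOn_of_bounded (M := Real.log (T + 2) * c n) measure_Ioc_lt_top.ne
      (hFmeas n).aestronglyMeasurable ?_
    exact (ae_restrict_iff' measurableSet_Ioc).2 (Eventually.of_forall (hFnorm n))
  have hsumc : Summable fun n ↦ c n := by
    have := summable_norm_montgomeryCoeff hx0
    refine this.congr fun n ↦ ?_
    rw [Complex.norm_real, Real.norm_of_nonneg (hc0 n)]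
  have hFsum : Summable fun n ↦ ∫ t in Set.Ioc 0 T, ‖F n t‖ := by
    refine Summable.of_nonneg_of_le (fun n ↦ integral_nonneg fun t ↦ norm_nonneg _) (fun n ↦ ?_)
      ((hsumc.mul_left (Real.log (T + 2))).mul_left T)
    calc ∫ t in Set.Ioc 0 T, ‖F n t‖ ≤ ∫ t in Set.Ioc 0 T, Real.log (T + 2) * c n := by
          refine setIntegral_mono_on (hFint n).norm (integrableOn_const (by simp)) measurableSet_Ioc
            fun t ht ↦ hFnorm n t ht
      _ = T * (Real.log (T + 2) * c n) := by
          rw [setIntegral_const, smul_eq_mul, Real.volume_real_Ioc_of_le hT, sub_zero]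
  -- interchange
  have hswap : ∫ t in (0 : ℝ)..T, (Real.log (t + 2) : ℂ) * montgomeryDirichletSum x t =
      ∑' n, ∫ t in (0 : ℝ)..T, F n t := by
    rw [intervalIntegral.integral_of_le hT]
    simp_rw [intervalIntegral.integral_of_le hT]
    rw [integral_tsum_of_summable_integral_norm hFint hFsum]
    refine setIntegral_congr_fun measurableSet_Ioc fun t _ ↦ ?_
    simp only [hF, montgomeryDirichletSum, hc]
    rw [← tsum_mul_left]
  -- the termwise bound
  have hterm : ∀ n, ‖∫ t in (0 : ℝ)..T, F n t‖ ≤ 2 / Real.log 2 * Real.log (T + 2) * c n := by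
    intro n
    rcases lt_or_ge n 2 with hn | hn
    · interval_cases n
      · simp [hF, hc]
      · simp [hF, hc, montgomeryCoeff]
    · have hln : Real.log 2 ≤ Real.log n := Real.log_le_log (by norm_num) (by exact_mod_cast hn)
      have e : (∫ t in (0 : ℝ)..T, F n t) =
          (c n : ℂ) * ∫ t in (0 : ℝ)..T, (Real.log (t + 2) : ℂ) * (n : ℂ) ^ (-((t : ℂ) * I)) := by
        rw [← intervalIntegral.integral_const_mul]
        refine intervalIntegral.integral_congr fun t _ ↦ ?_
        simp only [hF]; ring
      rw [e, norm_mul, Complex.norm_real, Real.norm_of_nonneg (hc0 n)]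
      have h1 := norm_integral_log_mul_cpow_le hn hT
      calc c n * ‖∫ t in (0 : ℝ)..T, (Real.log (t + 2) : ℂ) * (n : ℂ) ^ (-((t : ℂ) * I))‖
          ≤ c n * (2 * Real.log (T + 2) / Real.log n) := mul_le_mul_of_nonneg_left h1 (hc0 n)
        _ ≤ c n * (2 * Real.log (T + 2) / Real.log 2) := by
            refine mul_le_mul_of_nonneg_left ?_ (hc0 n)
            exact div_le_div_of_nonneg_left (by positivity) hl2 hln
        _ = 2 / Real.log 2 * Real.log (T + 2) * c n := by ring
  -- sum up
  have hsumterm : Summable fun n ↦ 2 / Real.log 2 * Real.log (T + 2) * c n := hsumc.mul_left _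
  have htsumc : ∑' n, c n ≤ 13 * (Real.log 4 + 4) * x := by
    refine Real.tsum_le_of_sum_range_le hc0 fun N ↦ ?_
    calc ∑ i ∈ Finset.range N, c i ≤ ∑ i ∈ Finset.range (N + 1), c i :=
          Finset.sum_le_sum_of_subset_of_nonneg (Finset.range_subset_range.2 (Nat.le_succ N)) fun i _ _ ↦ hc0 i
      _ = ∑ i ∈ Finset.Icc 1 N, c i :=
          DirichletMVT.sum_range_succ_eq_sum_Icc (fun i ↦ c i) (by simp [hc]) N
      _ ≤ 13 * (Real.log 4 + 4) * x := sum_Icc_montgomeryCoeff_le hx N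
  rw [hswap]
  calc ‖∑' n, ∫ t in (0 : ℝ)..T, F n t‖ ≤ ∑' n, ‖∫ t in (0 : ℝ)..T, F n t‖ :=
        norm_tsum_le_tsum_norm (hsumterm.of_nonneg_of_le (fun n ↦ norm_nonneg _) hterm)
    _ ≤ ∑' n, 2 / Real.log 2 * Real.log (T + 2) * c n :=
        (hsumterm.of_nonneg_of_le (fun n ↦ norm_nonneg _) hterm).tsum_le_tsum hterm hsumterm
    _ = 2 / Real.log 2 * Real.log (T + 2) * ∑' n, c n := tsum_mul_left
    _ ≤ 2 / Real.log 2 * Real.log (T + 2) * (13 * (Real.log 4 + 4) * x) :=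
        mul_le_mul_of_nonneg_left htsumc (by positivity)
    _ = 2 / Real.log 2 * (13 * (Real.log 4 + 4)) * x * Real.log (T + 2) := by ring

/-! ## §4. The `L²` algebra, keeping the cross term `⟨G, A⟩` -/

/-- `⟨c, z⟩_ℝ = c · Re z` for real `c` (the real inner product on `ℂ`). [folklore] -/
private theorem inner_ofReal_left (c : ℝ) (z : ℂ) : inner ℝ (c : ℂ) z = c * z.re := by
  simp [Complex.inner, mul_comm]

/-- For complex `a, g, r` and positive `q, s`:
`|‖−a+g+r‖² − ‖a‖² − ‖g‖² + 2⟨g,a⟩| ≤ (q‖a‖² + ‖r‖²/q) + (s‖g‖² + ‖r‖²/s) + ‖r‖²`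
(the cross terms with `r` by `2|⟨u,v⟩| ≤ λ‖u‖² + ‖v‖²/λ`; the cross term `⟨g,a⟩` is kept).
[folklore] -/
private theorem abs_norm_sq_three_sub_add_le (a g r : ℂ) {q s : ℝ} (hq : 0 < q) (hs : 0 < s) :
    |‖-a + g + r‖ ^ 2 - ‖a‖ ^ 2 - ‖g‖ ^ 2 + 2 * inner ℝ g a| ≤
      (q * ‖a‖ ^ 2 + ‖r‖ ^ 2 / q) + (s * ‖g‖ ^ 2 + ‖r‖ ^ 2 / s) + ‖r‖ ^ 2 := by
  have e1 : ‖-a + g + r‖ ^ 2 = ‖g - a‖ ^ 2 + 2 * inner ℝ (g - a) r + ‖r‖ ^ 2 := by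
    rw [show -a + g = g - a by ring]; exact norm_add_sq_real _ _
  have e2 : ‖g - a‖ ^ 2 = ‖g‖ ^ 2 - 2 * inner ℝ g a + ‖a‖ ^ 2 := norm_sub_sq_real _ _
  have e3 : inner ℝ (g - a) r = inner ℝ g r - inner ℝ a r := inner_sub_left _ _ _
  have b2 : |inner ℝ g r| ≤ ‖g‖ * ‖r‖ := abs_real_inner_le_norm _ _
  have b3 : |inner ℝ a r| ≤ ‖a‖ * ‖r‖ := abs_real_inner_le_norm _ _
  have c2 := two_mul_le_mul_sq_add_sq_div hq ‖a‖ ‖r‖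
  have c3 := two_mul_le_mul_sq_add_sq_div hs ‖g‖ ‖r‖
  rw [abs_le] at b2 b3 ⊢
  constructor <;> nlinarith [norm_nonneg a, norm_nonneg g, norm_nonneg r]

/-- Integrated form of `abs_norm_sq_three_sub_add_le` on `[0, T]`. [folklore] -/
private theorem abs_integral_norm_sq_three_sub_add_le {A G R : ℝ → ℂ} (hA : Continuous A)
    (hG : Continuous G) (hR : Continuous R) {T : ℝ} (hT : 0 ≤ T) {q s : ℝ} (hq : 0 < q) (hs : 0 < s) :
    |(∫ t in (0 : ℝ)..T, ‖-A t + G t + R t‖ ^ 2) - (∫ t in (0 : ℝ)..T, ‖A t‖ ^ 2) -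
        (∫ t in (0 : ℝ)..T, ‖G t‖ ^ 2) + 2 * ∫ t in (0 : ℝ)..T, inner ℝ (G t) (A t)| ≤
      (q * (∫ t in (0 : ℝ)..T, ‖A t‖ ^ 2) + (∫ t in (0 : ℝ)..T, ‖R t‖ ^ 2) / q) +
        (s * (∫ t in (0 : ℝ)..T, ‖G t‖ ^ 2) + (∫ t in (0 : ℝ)..T, ‖R t‖ ^ 2) / s) +
        (∫ t in (0 : ℝ)..T, ‖R t‖ ^ 2) := by
  have iA : IntervalIntegrable (fun t ↦ ‖A t‖ ^ 2) volume 0 T :=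
    (by fun_prop : Continuous fun t ↦ ‖A t‖ ^ 2).intervalIntegrable 0 T
  have iG : IntervalIntegrable (fun t ↦ ‖G t‖ ^ 2) volume 0 T :=
    (by fun_prop : Continuous fun t ↦ ‖G t‖ ^ 2).intervalIntegrable 0 T
  have iR : IntervalIntegrable (fun t ↦ ‖R t‖ ^ 2) volume 0 T :=
    (by fun_prop : Continuous fun t ↦ ‖R t‖ ^ 2).intervalIntegrable 0 T
  have iΦ : IntervalIntegrable (fun t ↦ ‖-A t + G t + R t‖ ^ 2) volume 0 T :=
    (by fun_prop : Continuous fun t ↦ ‖-A t + G t + R t‖ ^ 2).intervalIntegrable 0 T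
  have iX : IntervalIntegrable (fun t ↦ inner ℝ (G t) (A t)) volume 0 T :=
    (hG.inner hA).intervalIntegrable 0 T
  have hdiff : (∫ t in (0 : ℝ)..T, ‖-A t + G t + R t‖ ^ 2) - (∫ t in (0 : ℝ)..T, ‖A t‖ ^ 2) -
      (∫ t in (0 : ℝ)..T, ‖G t‖ ^ 2) + 2 * ∫ t in (0 : ℝ)..T, inner ℝ (G t) (A t) =
        ∫ t in (0 : ℝ)..T, (‖-A t + G t + R t‖ ^ 2 - ‖A t‖ ^ 2 - ‖G t‖ ^ 2 + 2 * inner ℝ (G t) (A t)) := by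
    rw [intervalIntegral.integral_add ((iΦ.sub iA).sub iG) (iX.const_mul 2),
      intervalIntegral.integral_sub (iΦ.sub iA) iG, intervalIntegral.integral_sub iΦ iA,
      intervalIntegral.integral_const_mul]
  set bound : ℝ → ℝ := fun t ↦
    (q * ‖A t‖ ^ 2 + ‖R t‖ ^ 2 / q) + (s * ‖G t‖ ^ 2 + ‖R t‖ ^ 2 / s) + ‖R t‖ ^ 2 with hbound
  have ibound : IntervalIntegrable bound volume 0 T := by
    rw [hbound]
    exact (by fun_prop : Continuous fun t ↦ (q * ‖A t‖ ^ 2 + ‖R t‖ ^ 2 / q) +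
      (s * ‖G t‖ ^ 2 + ‖R t‖ ^ 2 / s) + ‖R t‖ ^ 2).intervalIntegrable 0 T
  have hle : ‖∫ t in (0 : ℝ)..T, (‖-A t + G t + R t‖ ^ 2 - ‖A t‖ ^ 2 - ‖G t‖ ^ 2 +
      2 * inner ℝ (G t) (A t))‖ ≤ ∫ t in (0 : ℝ)..T, bound t :=
    intervalIntegral.norm_integral_le_of_norm_le hT (Eventually.of_forall fun t _ ↦ by
      rw [Real.norm_eq_abs]; exact abs_norm_sq_three_sub_add_le _ _ _ hq hs) ibound
  rw [hdiff, ← Real.norm_eq_abs]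
  refine hle.trans (le_of_eq ?_)
  rw [hbound]
  simp only
  have iGs : IntervalIntegrable (fun t ↦ s * ‖G t‖ ^ 2) volume 0 T := iG.const_mul s
  have iRq : IntervalIntegrable (fun t ↦ ‖R t‖ ^ 2 / q) volume 0 T := iR.div_const q
  have iRs : IntervalIntegrable (fun t ↦ ‖R t‖ ^ 2 / s) volume 0 T := iR.div_const s
  have iAq : IntervalIntegrable (fun t ↦ q * ‖A t‖ ^ 2) volume 0 T := iA.const_mul q
  rw [intervalIntegral.integral_add ((iAq.add iRq).add (iGs.add iRs)) iR,
    intervalIntegral.integral_add (iAq.add iRq) (iGs.add iRs), intervalIntegral.integral_add iAq iRq,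
    intervalIntegral.integral_add iGs iRs, intervalIntegral.integral_const_mul,
    intervalIntegral.integral_const_mul, intervalIntegral.integral_div, intervalIntegral.integral_div]

/-! ## §5. The core estimate, sharp form -/

set_option maxHeartbeats 1600000 in
/-- **The core estimate with the Goldston–Montgomery error terms.** For `1 ≤ x ≤ T`, `T ≥ 4`, with
`N = x T log T`, `Φ = (1/N) ∫_0^T |2x^{1/2-it} ∑_γ|²`, `a = (1/N) ∫_0^T |A(x,t)|²`,
`g = (1/N) ∫_0^T x^{-1} log²(t+2)`, `r = (1/N) ∫_0^T |R|²`, and the normalised cross term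
`κ = (2/N) ∫_0^T x^{-1/2} log(t+2) Re A(x,t) dt`:
`|(2π/(T log T)) F(x,T) − Φ| ≤ K log² T/T` (P2), `|a − log x/log T| ≤ K/√(log T)` (P3♯),
`|g − log T/x²| ≤ K/x²`, `r ≤ K/log T`, `|κ| ≤ K/T` (integration by parts), and
`|Φ − a − g + κ| ≤ (q a + r/q) + (s g + r/s) + r` for all positive `q, s`.
(Goldston 2005, §4 (4.5)–(4.9) with Goldston–Montgomery 1987, Lemmas 6–8.) [cite: GoldstonMontgomery1987, §3 Lemma 8] -/
theorem core_estimate_sharp (hRH : RiemannHypothesis) :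
    ∃ K : ℝ, 0 < K ∧ ∀ x : ℝ, 1 ≤ x → ∀ T : ℝ, 4 ≤ T → x ≤ T →
      ∃ Φ a g r κ : ℝ, 0 ≤ r ∧ 0 ≤ a ∧ 0 ≤ g ∧
        |2 * π / (T * Real.log T) * montgomeryPairSum x T - Φ| ≤ K * (Real.log T ^ 2 / T) ∧
        |a - Real.log x / Real.log T| ≤ K / Real.sqrt (Real.log T) ∧
        |g - Real.log T / x ^ 2| ≤ K / x ^ 2 ∧
        r ≤ K / Real.log T ∧ |κ| ≤ K / T ∧
        ∀ q s : ℝ, 0 < q → 0 < s →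
          |Φ - a - g + κ| ≤ (q * a + r / q) + (s * g + r / s) + r := by
  obtain ⟨C₁, hC₁⟩ := montgomery_explicit_formula_holds hRH
  obtain ⟨C₂, hC₂⟩ := montgomery_pairSum_eq_meanSquare_holds
  obtain ⟨C₃, hC₃⟩ := exists_meanSquare_dirichletSum_sharp
  obtain ⟨K₄, hK₄0, hK₄⟩ := exists_norm_integral_log_mul_dirichletSum_le
  set K : ℝ := 2 * π * |C₂| + 4 * |C₃| + 8 * C₁ ^ 2 + 4 * K₄ + 400 with hK
  have hK0 : 0 < K := by positivity
  have hKC₂ : 2 * π * C₂ ≤ K := by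
    have := le_abs_self C₂; have := abs_nonneg C₃; nlinarith [Real.pi_pos, sq_nonneg C₁]
  have hKC₃ : 4 * C₃ ≤ K := by
    have := le_abs_self C₃; have := abs_nonneg C₂; nlinarith [Real.pi_pos, sq_nonneg C₁]
  have hK50 : (50 : ℝ) ≤ K := by
    have := abs_nonneg C₃; have := abs_nonneg C₂; nlinarith [Real.pi_pos, sq_nonneg C₁]
  have hK342 : (342 : ℝ) + 8 * C₁ ^ 2 ≤ K := by
    have := abs_nonneg C₃; have := abs_nonneg C₂; nlinarith [Real.pi_pos, sq_nonneg C₁]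
  have hKK₄ : 4 * K₄ ≤ K := by
    have := abs_nonneg C₃; have := abs_nonneg C₂; nlinarith [Real.pi_pos, sq_nonneg C₁]
  refine ⟨K, hK0, fun x hx T hT hxT ↦ ?_⟩
  have hx0 : 0 < x := by linarith
  have hT0 : 0 < T := by linarith
  have hT2 : (2 : ℝ) ≤ T := by linarith
  have hlog : 0 < Real.log T := Real.log_pos (by linarith)
  have hlog1 : 1 ≤ Real.log T := by
    rw [← Real.log_exp 1]
    exact Real.log_le_log (Real.exp_pos 1) (by linarith [Real.exp_one_lt_d9])
  set N : ℝ := x * T * Real.log T with hN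
  have hN0 : 0 < N := by positivity
  -- the functions
  set S : ℝ → ℂ := montgomeryZeroSum x with hS
  set A : ℝ → ℂ := montgomeryDirichletSum x with hA
  set L : ℝ → ℂ := fun t ↦ 2 * (x : ℂ) ^ ((1 / 2 : ℂ) - t * I) * montgomeryZeroSum x t with hL
  set gR : ℝ → ℝ := fun t ↦ x ^ (-(1 / 2) : ℝ) * Real.log (|t| + 2) with hgR
  set G : ℝ → ℂ := fun t ↦ (gR t : ℂ) with hG
  have hGeq : ∀ t : ℝ, G t = (x : ℂ) ^ (-(1 / 2 : ℂ)) * (Real.log (|t| + 2) : ℂ) := by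
    intro t
    simp only [hG, hgR]
    rw [Complex.ofReal_mul, Complex.ofReal_cpow hx0.le]
    push_cast
    ring_nf
  set R : ℝ → ℂ := fun t ↦ L t + A t - G t with hR
  have hAc : Continuous A := continuous_montgomeryDirichletSum hx0
  have hLc : Continuous L := continuous_two_mul_cpow_mul_montgomeryZeroSum hx0
  have hgRc : Continuous gR := by
    simp only [hgR]
    exact continuous_const.mul (Continuous.log (by fun_prop) fun t ↦ by positivity)
  have hGc : Continuous G := Complex.continuous_ofReal.comp hgRc
  have hRc : Continuous R := (hLc.add hAc).sub hGc
  have hSc : Continuous S := continuous_montgomeryZeroSum hx0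
  -- the pointwise bound on `R`
  have hRb : ∀ t : ℝ, ‖R t‖ ≤ 64 * x / (|t| + 2) ^ 2 + 2 * C₁ := by
    intro t
    obtain ⟨E₁, E₂, hE₁, hE₂, heq⟩ := hC₁ x hx t
    have hRt : R t = 2 * (x : ℂ) ^ ((1 : ℂ) - t * I) / ((1 / 2 + t * I) * (3 / 2 - t * I)) +
        (x : ℂ) ^ (-(1 / 2 : ℂ)) * E₁ + E₂ := by
      simp only [hR, hL, hA, heq, hGeq t]; ring
    have hx12 : ‖(x : ℂ) ^ (-(1 / 2 : ℂ))‖ ≤ 1 := by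
      rw [norm_cpow_eq_rpow_re_of_pos hx0]
      exact Real.rpow_le_one_of_one_le_of_nonpos hx (by simp)
    have hE₂' : ‖E₂‖ ≤ C₁ := by
      have hC₁0 : 0 ≤ C₁ := (norm_nonneg _).trans hE₁
      have h1 : x ^ (-2 : ℝ) ≤ 1 := Real.rpow_le_one_of_one_le_of_nonpos hx (by norm_num)
      have h2 : x ^ (-2 : ℝ) / (|t| + 2) ≤ 1 := by
        rw [div_le_one (by positivity)]; linarith [abs_nonneg t]
      exact hE₂.trans (mul_le_of_le_one_right hC₁0 h2)
    have hmid : ‖(x : ℂ) ^ (-(1 / 2 : ℂ)) * E₁‖ ≤ C₁ := by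
      rw [norm_mul]
      calc ‖(x : ℂ) ^ (-(1 / 2 : ℂ))‖ * ‖E₁‖ ≤ 1 * C₁ :=
            mul_le_mul hx12 hE₁ (norm_nonneg _) zero_le_one
        _ = C₁ := one_mul _
    rw [hRt]
    calc ‖2 * (x : ℂ) ^ ((1 : ℂ) - t * I) / ((1 / 2 + t * I) * (3 / 2 - t * I)) +
          (x : ℂ) ^ (-(1 / 2 : ℂ)) * E₁ + E₂‖
        ≤ ‖2 * (x : ℂ) ^ ((1 : ℂ) - t * I) / ((1 / 2 + t * I) * (3 / 2 - t * I)) +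
          (x : ℂ) ^ (-(1 / 2 : ℂ)) * E₁‖ + ‖E₂‖ := norm_add_le _ _
      _ ≤ (‖2 * (x : ℂ) ^ ((1 : ℂ) - t * I) / ((1 / 2 + t * I) * (3 / 2 - t * I))‖ +
          ‖(x : ℂ) ^ (-(1 / 2 : ℂ)) * E₁‖) + ‖E₂‖ := by gcongr; exact norm_add_le _ _
      _ ≤ (64 * x / (|t| + 2) ^ 2 + C₁) + C₁ := by gcongr; exact norm_mainTermB_le hx0 t
      _ = 64 * x / (|t| + 2) ^ 2 + 2 * C₁ := by ring
  -- the integrals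
  set IS : ℝ := ∫ t in (0 : ℝ)..T, ‖S t‖ ^ 2 with hIS
  set IA : ℝ := ∫ t in (0 : ℝ)..T, ‖A t‖ ^ 2 with hIA
  set IG : ℝ := ∫ t in (0 : ℝ)..T, ‖G t‖ ^ 2 with hIG
  set IR : ℝ := ∫ t in (0 : ℝ)..T, ‖R t‖ ^ 2 with hIR
  set IX : ℝ := ∫ t in (0 : ℝ)..T, inner ℝ (G t) (A t) with hIX
  set J : ℝ := ∫ t in (0 : ℝ)..T, Real.log (t + 2) ^ 2 with hJ
  set CI : ℂ := ∫ t in (0 : ℝ)..T, (Real.log (t + 2) : ℂ) * A t with hCI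
  have hIL : ∫ t in (0 : ℝ)..T, ‖-A t + G t + R t‖ ^ 2 = 4 * x * IS := by
    rw [hIS, ← intervalIntegral.integral_const_mul]
    refine intervalIntegral.integral_congr fun t _ ↦ ?_
    have : -A t + G t + R t = L t := by simp only [hR]; ring
    simp only [this, hL, hS, norm_sq_two_mul_cpow_mul hx0]
  have hIGJ : IG = x⁻¹ * J := by
    rw [hIG, show (fun t ↦ ‖G t‖ ^ 2) = fun t ↦ ‖(x : ℂ) ^ (-(1 / 2 : ℂ)) * (Real.log (|t| + 2) : ℂ)‖ ^ 2
      from funext fun t ↦ by rw [hGeq t]]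
    exact integral_norm_sq_cpow_neg_half_mul_log hx0 hT0.le
  have hJb : |J - T * Real.log T ^ 2| ≤ 50 * T * Real.log T := abs_integral_log_add_two_sq_sub_le hT2
  have hIRb : IR ≤ 342 * x ^ 2 + 8 * C₁ ^ 2 * T := integral_norm_sq_remainder_le hRc hx0 hRb hT0.le
  have hIR0 : 0 ≤ IR := intervalIntegral.integral_nonneg hT0.le fun t _ ↦ by positivity
  have hIA0 : 0 ≤ IA := intervalIntegral.integral_nonneg hT0.le fun t _ ↦ by positivity
  have hIG0 : 0 ≤ IG := intervalIntegral.integral_nonneg hT0.le fun t _ ↦ by positivity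
  have hISb : |montgomeryPairSum x T - 2 / π * IS| ≤ C₂ * Real.log T ^ 3 := hC₂ x hx0 T hT2
  have hIAb : |IA - T * x * Real.log x| ≤ C₃ * (T * x + x ^ 2 + x * Real.sqrt (x * T * (Real.log x + 1))) :=
    hC₃ x hx T hT
  -- the cross term: `IX = x^{-1/2} Re CI`, `|CI| ≤ K₄ x log(T+2)`
  have hIXeq : IX = x ^ (-(1 / 2) : ℝ) * CI.re := by
    have h1 : IX = ∫ t in (0 : ℝ)..T, x ^ (-(1 / 2) : ℝ) * ((Real.log (t + 2) : ℂ) * A t).re := by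
      rw [hIX]
      refine intervalIntegral.integral_congr fun t ht ↦ ?_
      rw [Set.uIcc_of_le hT0.le] at ht
      simp only [hG, hgR, inner_ofReal_left, Complex.re_ofReal_mul, abs_of_nonneg ht.1]
      ring
    rw [h1, intervalIntegral.integral_const_mul]
    congr 1
    have hint : IntervalIntegrable (fun t ↦ (Real.log (t + 2) : ℂ) * A t) volume 0 T := by
      refine (ContinuousOn.mul ?_ hAc.continuousOn).intervalIntegrable
      refine Complex.continuous_ofReal.comp_continuousOn (ContinuousOn.log (by fun_prop) fun t ht ↦ ?_)
      rw [Set.uIcc_of_le hT0.le] at ht; linarith [ht.1]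
    have := Complex.reCLM.intervalIntegral_comp_comm hint
    simpa using this
  have hCIb : ‖CI‖ ≤ K₄ * x * Real.log (T + 2) := hK₄ x hx T hT0.le
  have hlogT2 : Real.log (T + 2) ≤ 2 * Real.log T := by
    have h1 : T + 2 ≤ T ^ 2 := by nlinarith
    calc Real.log (T + 2) ≤ Real.log (T ^ 2) := Real.log_le_log (by linarith) h1
      _ = 2 * Real.log T := by rw [Real.log_pow]; norm_num
  have hx12le : x ^ (-(1 / 2) : ℝ) ≤ 1 := Real.rpow_le_one_of_one_le_of_nonpos hx (by norm_num)
  have hx12pos : 0 < x ^ (-(1 / 2) : ℝ) := Real.rpow_pos_of_pos hx0 _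
  have hIXb : |IX| ≤ K₄ * x * (2 * Real.log T) := by
    rw [hIXeq, abs_mul, abs_of_pos hx12pos]
    calc x ^ (-(1 / 2) : ℝ) * |CI.re| ≤ 1 * ‖CI‖ :=
          mul_le_mul hx12le (Complex.abs_re_le_norm CI) (abs_nonneg _) zero_le_one
      _ ≤ K₄ * x * Real.log (T + 2) := by rw [one_mul]; exact hCIb
      _ ≤ K₄ * x * (2 * Real.log T) := mul_le_mul_of_nonneg_left hlogT2 (by positivity)
  have h5raw := fun q s (hq : (0 : ℝ) < q) (hs : (0 : ℝ) < s) ↦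
    abs_integral_norm_sq_three_sub_add_le hAc hGc hRc hT0.le hq hs
  refine ⟨4 * x * IS / N, IA / N, IG / N, IR / N, 2 * IX / N, by positivity, by positivity, by positivity,
    ?_, ?_, ?_, ?_, ?_, ?_⟩
  · -- `Φ` versus the form factor
    have e : 2 * π / (T * Real.log T) * montgomeryPairSum x T - 4 * x * IS / N =
        2 * π / (T * Real.log T) * (montgomeryPairSum x T - 2 / π * IS) := by
      rw [hN]; field_simp; ring
    rw [e, abs_mul, abs_of_pos (by positivity)]
    calc 2 * π / (T * Real.log T) * |montgomeryPairSum x T - 2 / π * IS|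
        ≤ 2 * π / (T * Real.log T) * (C₂ * Real.log T ^ 3) := by gcongr
      _ = 2 * π * C₂ * (Real.log T ^ 2 / T) := by field_simp
      _ ≤ K * (Real.log T ^ 2 / T) := by gcongr
  · -- `a` versus `log x / log T`
    set sL : ℝ := Real.sqrt (Real.log T) with hsL
    have hsL0 : 0 < sL := Real.sqrt_pos.2 hlog
    have hsL2 : sL ^ 2 = Real.log T := Real.sq_sqrt hlog.le
    have hsL1 : 1 ≤ sL := by rw [hsL]; exact Real.one_le_sqrt.2 hlog1
    have hlx : 0 ≤ Real.log x := Real.log_nonneg hx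
    have hlxT : Real.log x ≤ Real.log T := Real.log_le_log hx0 hxT
    have e : IA / N - Real.log x / Real.log T = (IA - T * x * Real.log x) / N := by
      rw [hN]; field_simp
    rw [e, abs_div, abs_of_pos hN0, div_le_div_iff₀ hN0 hsL0]
    -- `√(xT(log x + 1)) ≤ 2 T sL`
    have hsq : Real.sqrt (x * T * (Real.log x + 1)) ≤ 2 * T * sL := by
      have h1 : x * T * (Real.log x + 1) ≤ (2 * T * sL) ^ 2 := by
        have e : (2 * T * sL) ^ 2 = 4 * T ^ 2 * Real.log T := by rw [mul_pow, mul_pow, hsL2]; ring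
        rw [e]
        have hl2 : Real.log x + 1 ≤ 2 * Real.log T := by linarith
        have s1 : x * T * (Real.log x + 1) ≤ x * T * (2 * Real.log T) :=
          mul_le_mul_of_nonneg_left hl2 (by positivity)
        have s2 : x * T * (2 * Real.log T) ≤ T * T * (2 * Real.log T) :=
          mul_le_mul_of_nonneg_right (mul_le_mul_of_nonneg_right hxT hT0.le) (by linarith)
        nlinarith [hlog.le, sq_nonneg T]
      calc Real.sqrt (x * T * (Real.log x + 1)) ≤ Real.sqrt ((2 * T * sL) ^ 2) := Real.sqrt_le_sqrt h1
        _ = 2 * T * sL := Real.sqrt_sq (by positivity)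
    have hPpos : 0 < T * x + x ^ 2 + x * Real.sqrt (x * T * (Real.log x + 1)) := by positivity
    have hC₃0 : 0 ≤ C₃ := (mul_nonneg_iff_of_pos_right hPpos).1 ((abs_nonneg _).trans hIAb)
    have hP : T * x + x ^ 2 + x * Real.sqrt (x * T * (Real.log x + 1)) ≤ x * T * (4 * sL) := by
      have hx2 : x ^ 2 ≤ T * x := by nlinarith
      have h3 : x * Real.sqrt (x * T * (Real.log x + 1)) ≤ x * (2 * T * sL) :=
        mul_le_mul_of_nonneg_left hsq hx0.le
      have h4 : T * x ≤ T * x * sL := le_mul_of_one_le_right (by positivity) hsL1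
      nlinarith
    calc |IA - T * x * Real.log x| * sL
        ≤ C₃ * (T * x + x ^ 2 + x * Real.sqrt (x * T * (Real.log x + 1))) * sL :=
          mul_le_mul_of_nonneg_right hIAb hsL0.le
      _ ≤ C₃ * (x * T * (4 * sL)) * sL := by gcongr
      _ = 4 * C₃ * (x * T * sL ^ 2) := by ring
      _ = 4 * C₃ * N := by rw [hsL2, hN]
      _ ≤ K * N := by gcongr
  · -- `g` versus `log T / x²`
    have hden : 0 < x ^ 2 * T * Real.log T := by positivity
    have e : IG / N - Real.log T / x ^ 2 = (J - T * Real.log T ^ 2) / (x ^ 2 * T * Real.log T) := by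
      rw [hIGJ, hN]; field_simp
    rw [e, abs_div, abs_of_pos hden, div_le_div_iff₀ hden (by positivity)]
    calc |J - T * Real.log T ^ 2| * x ^ 2 ≤ 50 * T * Real.log T * x ^ 2 := by gcongr
      _ = 50 * (x ^ 2 * T * Real.log T) := by ring
      _ ≤ K * (x ^ 2 * T * Real.log T) := by gcongr
  · -- `r`
    rw [div_le_div_iff₀ hN0 hlog]
    calc IR * Real.log T ≤ (342 * x ^ 2 + 8 * C₁ ^ 2 * T) * Real.log T :=
          mul_le_mul_of_nonneg_right hIRb hlog.le
      _ ≤ (342 * (x * T) + 8 * C₁ ^ 2 * (x * T)) * Real.log T := by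
          gcongr
          · nlinarith
          · nlinarith
      _ = (342 + 8 * C₁ ^ 2) * N := by rw [hN]; ring
      _ ≤ K * N := by gcongr
  · -- `κ`
    rw [abs_div, abs_of_pos hN0, div_le_div_iff₀ hN0 hT0, abs_mul, abs_two]
    calc 2 * |IX| * T ≤ 2 * (K₄ * x * (2 * Real.log T)) * T := by gcongr
      _ = 4 * K₄ * N := by rw [hN]; ring
      _ ≤ K * N := by gcongr
  · -- the cross-term inequality, divided by `N`
    intro q s hq hs
    have h := h5raw q s hq hs
    rw [hIL] at h
    have e1 : 4 * x * IS / N - IA / N - IG / N + 2 * IX / N = (4 * x * IS - IA - IG + 2 * IX) / N := by ring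
    rw [e1, abs_div, abs_of_pos hN0, div_le_iff₀ hN0]
    refine h.trans (le_of_eq ?_)
    field_simp
    ring

/-! ## §6. Montgomery's theorem with the error term `O(1/√log T)` -/

/-- `(log T)³ ≤ T` for all large `T`. [folklore] -/
private theorem eventually_log_pow_three_le : ∀ᶠ T : ℝ in atTop, Real.log T ^ 3 ≤ T := by
  have h := (Real.isLittleO_pow_log_id_atTop (n := 3)).bound (c := 1) one_pos
  filter_upwards [h, eventually_ge_atTop 1] with T hT hT1
  have h1 : 0 ≤ Real.log T := Real.log_nonneg hT1
  rw [Real.norm_of_nonneg (by positivity), one_mul, id, Real.norm_of_nonneg (by linarith)] at hT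
  exact hT

set_option maxHeartbeats 800000 in
/-- **Montgomery's theorem with the Goldston–Montgomery error term, `0 ≤ α ≤ 1`** (BGSTB 2025, (MT)/(MTeq):
"Assume the Riemann Hypothesis. … as `T → ∞`,
`F(α) = T^{−2α} log T (1 + O(1/√log T)) + α + O(1/√log T)` uniformly for `0 ≤ α ≤ 1`";
Goldston–Montgomery 1987, Lemma 8 (with an extra `√log log T`); Montgomery 1973, Theorem, on `[0, 1−ε]`
with `o(1)`): assuming RH, there is `C` such that for all large `T` and all `α ∈ [0, 1]`,
`|F(α, T) − (T^{−2α} log T + α)| ≤ C (T^{−2α} log T + 1)/√(log T)`.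
[claim: BaluyotGoldstonSuriajayaTurnageButterbaugh2025, status: under-review] -/
theorem montgomery_pair_correlation_sqrtLog_Icc (hRH : RiemannHypothesis) :
    ∃ C : ℝ, ∀ᶠ T : ℝ in atTop, ∀ α : ℝ, α ∈ Set.Icc (0 : ℝ) 1 →
      |montgomeryFormFactor α T - (T ^ (-2 * α) * Real.log T + α)| ≤
        C * (T ^ (-2 * α) * Real.log T + 1) / Real.sqrt (Real.log T) := by
  obtain ⟨K, hK, hcore⟩ := core_estimate_sharp hRH
  refine ⟨8 * K + 2, ?_⟩
  filter_upwards [eventually_ge_atTop 4, eventually_log_pow_three_le] with T hT4 hT3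
  intro α hα
  obtain ⟨hα0, hα1⟩ := hα
  have hT0 : 0 < T := by linarith
  have hT1 : (1 : ℝ) ≤ T := by linarith
  have hlog : 0 < Real.log T := Real.log_pos (by linarith)
  have hlog1 : 1 ≤ Real.log T := by
    rw [← Real.log_exp 1]
    exact Real.log_le_log (Real.exp_pos 1) (by linarith [Real.exp_one_lt_d9])
  set sL : ℝ := Real.sqrt (Real.log T) with hsL
  have hsL0 : 0 < sL := Real.sqrt_pos.2 hlog
  have hsL2 : sL ^ 2 = Real.log T := Real.sq_sqrt hlog.le
  have hsL1 : 1 ≤ sL := by rw [hsL]; exact Real.one_le_sqrt.2 hlog1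
  have hsLL : sL ≤ Real.log T := by nlinarith
  have hLT : Real.log T ≤ T := by linarith [Real.log_le_sub_one_of_pos hT0]
  -- `x = T^α`
  set x : ℝ := T ^ α with hx
  have hx0 : 0 < x := Real.rpow_pos_of_pos hT0 α
  have hx1 : 1 ≤ x := Real.one_le_rpow hT1 hα0
  have hxT : x ≤ T := by
    rw [hx]; conv_rhs => rw [← Real.rpow_one T]
    exact Real.rpow_le_rpow_of_exponent_le hT1 hα1
  obtain ⟨Φ, a, g, r, κ, hr0, ha0, hg0, h1, h2, h3, h4, h5, h6⟩ := hcore x hx1 T hT4 hxT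
  -- the two main terms
  set u : ℝ := T ^ (-2 * α) * Real.log T with hu
  have hx2 : x ^ 2 = T ^ (2 * α) := by
    rw [hx, ← Real.rpow_natCast, ← Real.rpow_mul hT0.le]; congr 1; push_cast; ring
  have hTa : T ^ (-2 * α) = 1 / x ^ 2 := by
    rw [hx2, show (-2 * α) = -(2 * α) by ring, Real.rpow_neg hT0.le, one_div]
  have hu0 : 0 ≤ u := by positivity
  have hux : Real.log T / x ^ 2 = u := by rw [hu, hTa]; ring
  have hKx : K / x ^ 2 = K * u / Real.log T := by
    rw [hu, hTa]; field_simp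
  have hαx : Real.log x / Real.log T = α := by
    rw [hx, Real.log_rpow hT0]; exact mul_div_cancel_right₀ α hlog.ne'
  rw [hαx] at h2
  rw [hux, hKx] at h3
  -- the form factor
  have hF : montgomeryFormFactor α T = 2 * π / (T * Real.log T) * montgomeryPairSum x T :=
    montgomeryFormFactor_eq_montgomeryPairSum α hT0
  -- collect
  have h6' := h6 (1 / sL) (1 / sL) (by positivity) (by positivity)
  have e_rq : r / (1 / sL) = r * sL := by field_simp
  rw [e_rq] at h6'
  have ha_le : a ≤ 1 + K := by
    have := (abs_le.1 h2).2
    have : K / sL ≤ K := div_le_self hK.le hsL1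
    linarith
  have hKuL : K * u / Real.log T ≤ K * u / sL := div_le_div_of_nonneg_left (by positivity) hsL0 hsLL
  have hg_le : g ≤ u + K * u := by
    have : K * u / Real.log T ≤ K * u := div_le_self (by positivity) hlog1
    linarith [(abs_le.1 h3).2]
  have hr1 : r * sL ≤ K / sL := by
    have : r * sL ≤ K / Real.log T * sL := mul_le_mul_of_nonneg_right h4 hsL0.le
    rw [← hsL2] at this
    calc r * sL ≤ K / sL ^ 2 * sL := this
      _ = K / sL := by field_simp
  have hr2 : r ≤ K / sL :=
    h4.trans (div_le_div_of_nonneg_left hK.le hsL0 hsLL)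
  have hκ : |κ| ≤ K / sL := h5.trans (div_le_div_of_nonneg_left hK.le hsL0 (hsLL.trans hLT))
  have hls : Real.log T ^ 2 / T ≤ 1 / sL := by
    rw [div_le_div_iff₀ hT0 hsL0, one_mul]
    calc Real.log T ^ 2 * sL ≤ Real.log T ^ 2 * Real.log T :=
          mul_le_mul_of_nonneg_left hsLL (by positivity)
      _ = Real.log T ^ 3 := by ring
      _ ≤ T := hT3
  have h1' : |2 * π / (T * Real.log T) * montgomeryPairSum x T - Φ| ≤ K / sL := by
    refine h1.trans ?_
    rw [div_eq_mul_one_div K sL]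
    exact mul_le_mul_of_nonneg_left hls hK.le
  have hqa : 1 / sL * a ≤ (1 + K) / sL := by
    rw [one_div_mul_eq_div]; exact div_le_div_of_nonneg_right ha_le hsL0.le
  have hsg : 1 / sL * g ≤ (u + K * u) / sL := by
    rw [one_div_mul_eq_div]; exact div_le_div_of_nonneg_right hg_le hsL0.le
  have hmid : |Φ - a - g + κ| ≤ (1 + K) / sL + K / sL + ((u + K * u) / sL + K / sL) + K / sL := by
    refine h6'.trans ?_
    linarith
  have hgu : |g - u| ≤ K * u / sL := h3.trans hKuL
  -- put together
  have habs : |montgomeryFormFactor α T - (u + α)| ≤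
      |2 * π / (T * Real.log T) * montgomeryPairSum x T - Φ| + |Φ - a - g + κ| + |κ| + |a - α| +
        |g - u| := by
    rw [hF]
    set P := 2 * π / (T * Real.log T) * montgomeryPairSum x T - Φ with hP
    set Q := Φ - a - g + κ with hQ
    have esplit : 2 * π / (T * Real.log T) * montgomeryPairSum x T - (u + α) =
        P + Q - κ + (a - α) + (g - u) := by rw [hP, hQ]; ring
    rw [esplit]
    have t1 := abs_add_le (P + Q - κ + (a - α)) (g - u)
    have t2 := abs_add_le (P + Q - κ) (a - α)
    have t3 := abs_sub (P + Q) κ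
    have t4 := abs_add_le P Q
    linarith
  have htot : |montgomeryFormFactor α T - (u + α)| ≤ (8 * K + 2) * (u + 1) / sL := by
    calc |montgomeryFormFactor α T - (u + α)|
        ≤ K / sL + ((1 + K) / sL + K / sL + ((u + K * u) / sL + K / sL) + K / sL) + K / sL + K / sL +
            K * u / sL := by linarith [habs, h1', hmid, hκ, h2, hgu]
      _ = ((7 * K + 1) + (2 * K + 1) * u) / sL := by field_simp; ring
      _ ≤ (8 * K + 2) * (u + 1) / sL := by
          refine div_le_div_of_nonneg_right ?_ hsL0.le
          nlinarith [hK.le, hu0]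
  have efin : T ^ (-2 * α) * Real.log T + α = u + α := by rw [hu]
  rw [efin]
  exact htot

/-- **Montgomery's theorem with the Goldston–Montgomery error term, `|α| ≤ 1`** (evenness
`F(−α, T) = F(α, T)`): assuming RH, there is `C` such that for all large `T` and all `|α| ≤ 1`,
`|F(α, T) − (T^{−2|α|} log T + |α|)| ≤ C (T^{−2|α|} log T + 1)/√(log T)`. Compare the tree's
`montgomery_pair_correlation_restricted` (`o(1)` form on `|α| ≤ 1 − δ`).
[claim: BaluyotGoldstonSuriajayaTurnageButterbaugh2025, status: under-review] -/
theorem montgomery_pair_correlation_sqrtLog (hRH : RiemannHypothesis) :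
    ∃ C : ℝ, ∀ᶠ T : ℝ in atTop, ∀ α : ℝ, |α| ≤ 1 →
      |montgomeryFormFactor α T - (T ^ (-2 * |α|) * Real.log T + |α|)| ≤
        C * (T ^ (-2 * |α|) * Real.log T + 1) / Real.sqrt (Real.log T) := by
  obtain ⟨C, hC⟩ := montgomery_pair_correlation_sqrtLog_Icc hRH
  refine ⟨C, ?_⟩
  filter_upwards [hC] with T hT α hα
  have hmem : |α| ∈ Set.Icc (0 : ℝ) 1 := ⟨abs_nonneg α, hα⟩
  have h := hT |α| hmem
  rcases le_or_gt 0 α with h0 | h0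
  · rw [abs_of_nonneg h0] at h ⊢; exact h
  · rw [abs_of_neg h0] at h ⊢
    rwa [montgomeryFormFactor_neg] at h

end Montgomery

end Literature.NumberTheory.LFunctions

end
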